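import Summits.ValiantsHypothesis.ValiantsHypothesis.Theses.UlrichPadded
import Literature.Computability.AlgebraicComplexity.RankOneDeterminantalExpressionsProofs

/-!
# Refutation of `UlrichPadded.NoTightInfinity` (stmt-ValiantsHypothesis-5668) — refuted-substantive

The crux claims: for `n ≥ 3` and EVERY affine determinantal representation `A` of `per_n`, `per_n`
divides every submaximal minor of the linear part `L` of `A` (padding order `j ≥ 1`, "no representation
is tight at infinity").  This is false already at the optimal size `m = dc(per₃) = 7`.

Witness.  Let `G` be Grenet's `7 × 7` matrix of `per₃` (rows/columns `s, u₀, u₁, u₂, v₀, v₁, v₂`; row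
`s = (0, X(0,0), X(1,0), X(2,0), 0, 0, 0)`, unit diagonal on the `u`- and `v`-blocks, `(u,v)`-block
`N = !![0, X(2,1), X(1,1); X(2,1), 0, X(0,1); X(1,1), X(0,1), 0]`, column `s = X(k,2)` in the `v`-rows).
Twist it by the two UNIPOTENT POLYNOMIAL gauge matrices `D_V = 1 + V`, `D_U = 1 + U` with
`U = (e₀ × x_{•0}) e₀ᵀ` (entries `U (u₁,u₀) = -X(2,0)`, `U (u₂,u₀) = X(1,0)`) and `V = e₀ (e₀ × x_{•2})ᵀ`
(entries `V (v₀,v₁) = -X(2,2)`, `V (v₀,v₂) = X(1,2)`): the Koszul relations `x_{•0} · U = 0`, `V · x_{•2} = 0`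
keep `A := D_V * G * D_U` AFFINE (every entry is `0`, `1` or `±` a variable), `U² = V² = 0` gives
`det D_U = det D_V = 1`, so `det A = per₃`.  But the linear part `L` of `A` has generic corank ONE (in
Grenet's `L` the three `u`-columns are the multiples `X(j,0)·e_s` of one vector and the three `v`-rows
likewise; the twist makes column `u₀` and row `v₀` independent, leaving a single proportionality on
each side), and `adj L = g · ĉ ŵᵀ` with `ĉ = X(2,0) e_{u₁} - X(1,0) e_{u₂}`, `ŵ = X(2,2) e_{v₁} - X(1,2) e_{v₂}`,
`g = (X(1,1)X(2,0) + X(1,0)X(2,1)) · (X(1,2)X(2,1) + X(1,1)X(2,2))`; e.g.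
`adj L (u₁) (v₁) = X(2,0) X(2,2) g`, a product of linear and quadratic forms, is not divisible by the
irreducible cubic `per₃`.  Certificate used below: at the point `X(0,c) = 0`, all other `X = 1`
(a zero of `per₃`) the entry `adj L 2 5` evaluates to `det M' = 4 ≠ 0`, shown by an explicit inverse of
`M'`.  In the route's language: `j = 0`, `(d_c, d_w, j) = (3, 3, 0)`, the budget `6 = 3 + 3 + 0` is
TIGHT AT INFINITY, and the generic point at infinity of `V(per₃)` is a corank-ONE point of the padded
matrix `x₀A₀ + L`.

Classification: refuted-substantive.  The load-bearing claim "j ≥ 1 for every representation" fails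
for an honest optimal-size representation; no side condition was forgotten (the planner's own
"why it might fail" names exactly this failure mode).  Repairs tried: (1) restrict to `m = dc(per_n)`
— the witness has `m = 7 = dc(per₃)`; (2) restrict to graded (torus-equivariant / layered branching
program) representations — then corank `L ≥ 2` does hold (row/column level count + `per_n ∉ (ℓ₁, ℓ₂)`
by von zur Gathen's codim-5 theorem), but `j`, `exc_c`, `exc_w` are NOT invariants of the cokernel
module: the unipotent gauge `GL_m(ℂ[x]) × GL_m(ℂ[x])` moves `(exc_c, exc_w, j)` from Grenet's
`(0,0,2)` to `(1,1,0)` without changing the representation's cokernel, so no statement quantifying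
over all affine representations can forbid the tight regime.  barrier-candidate: padded-budget
coordinates are gauge-dependent; only gauge-invariant functions of `(exc_c, exc_w, j)` can carry a
lower bound.  Sketch, exact arithmetic and the search that found the witness: refuter folder
`py/gauge1.py`, `py/witness.py` (cdisprove unit, 2026-08-15).
-/

noncomputable section

namespace Summit.ValiantsHypothesis.ValiantsHypothesis.Theses.UlrichPadded

open scoped BigOperators Topology Manifold Classical MeasureTheory ProbabilityTheory Matrix InnerProductSpace ComplexConjugate ContinuousMap
open Filter Set Function TopologicalSpace MeasureTheory

/-- **Record of the replaced/dropped route item `NoTightInfinity`** = stmt-ValiantsHypothesis-5668 (ledger signature verbatim, in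
the route file's namespace and `open` context; NOT a route item): after `UlrichPaddedNoTightInfinity_refuted` (below) closed the
item `refuted` at ebe5c198f9c0, the route repair (`restate` under a new name, or `drop`) removed
this constant from the gate-written Theses file, while the Theorems file below — append-only,
statement text fixed — still names it ("Unknown identifier" in the full builds of 2026-08-16).
Re-declared here under its original fully-qualified name and definiens solely so that this record
keeps elaborating. FALSE (refuted below). -/
def NoTightInfinity : Prop :=
  ∀ n : ℕ, 3 ≤ n → ∀ (m : ℕ) (A : Matrix (Fin m) (Fin m) (MvPolynomial (Fin n × Fin n) ℂ)), Literature.Computability.AlgebraicComplexity.IsAffineDetRepr (Literature.Computability.AlgebraicComplexity.perPoly (Fin n) ℂ) A → ∀ i j, (Matrix.of fun a b => MvPolynomial.homogeneousComponent 1 (A a b)).adjugate i j ∈ Ideal.span {Literature.Computability.AlgebraicComplexity.perPoly (Fin n) ℂ}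

end Summit.ValiantsHypothesis.ValiantsHypothesis.Theses.UlrichPadded

namespace Summit.ValiantsHypothesis.Theorems

open MvPolynomial Matrix
open Literature.Computability.AlgebraicComplexity
open Summit.ValiantsHypothesis.ValiantsHypothesis.Theses.UlrichPadded

-- one declaration inspecting all 49 entries of several explicit `7 × 7` matrices at once
set_option maxHeartbeats 1600000 in
/-- Refutes `UlrichPadded.NoTightInfinity` (stmt-ValiantsHypothesis-5668) [refuted-substantive]: the
unipotent Koszul twist `A = (1 + V) * Grenet * (1 + U)` is an affine determinantal representation of
`perPoly (Fin 3) ℂ` whose linear part `L` has `adj L 2 5 ∉ (per₃)` — at the zero `X(0,·) = 0, X = 1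
elsewhere` of `per₃` it evaluates to `4`.  Witness `n = 3, m = 7, i = 2, j = 5`. [folklore] -/
theorem UlrichPaddedNoTightInfinity_refuted : ¬ NoTightInfinity := by
  intro hNT
  -- ### the witness `A`, the gauge factor `DU = (1 + U)⁻¹ = 1 - U`, Grenet's eliminations `E1, E2`,
  -- the intermediate products and the linear part `L`
  obtain ⟨A, hA⟩ : ∃ M : Matrix (Fin 7) (Fin 7) (MvPolynomial (Fin 3 × Fin 3) ℂ), M =
      !![0, X (0,0), X (1,0), X (2,0), 0, 0, 0;
         0, 1, 0, 0, 0, X (2,1), X (1,1);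
         0, -X (2,0), 1, 0, X (2,1), 0, X (0,1);
         0, X (1,0), 0, 1, X (1,1), X (0,1), 0;
         X (0,2), 0, 0, 0, 1, -X (2,2), X (1,2);
         X (1,2), 0, 0, 0, 0, 1, 0;
         X (2,2), 0, 0, 0, 0, 0, 1] := ⟨_, rfl⟩
  obtain ⟨DU, hDU⟩ : ∃ M : Matrix (Fin 7) (Fin 7) (MvPolynomial (Fin 3 × Fin 3) ℂ), M =
      !![1, 0, 0, 0, 0, 0, 0;
         0, 1, 0, 0, 0, 0, 0;
         0, X (2,0), 1, 0, 0, 0, 0;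
         0, -X (1,0), 0, 1, 0, 0, 0;
         0, 0, 0, 0, 1, 0, 0;
         0, 0, 0, 0, 0, 1, 0;
         0, 0, 0, 0, 0, 0, 1] := ⟨_, rfl⟩
  obtain ⟨E1, hE1⟩ : ∃ M : Matrix (Fin 7) (Fin 7) (MvPolynomial (Fin 3 × Fin 3) ℂ), M =
      !![1, 0, 0, 0, 0, 0, 0;
         0, 1, 0, 0, 0, -X (2,1), -X (1,1);
         0, 0, 1, 0, -X (2,1), 0, -X (0,1);
         0, 0, 0, 1, -X (1,1), -X (0,1), 0;
         0, 0, 0, 0, 1, 0, 0;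
         0, 0, 0, 0, 0, 1, 0;
         0, 0, 0, 0, 0, 0, 1] := ⟨_, rfl⟩
  obtain ⟨E2, hE2⟩ : ∃ M : Matrix (Fin 7) (Fin 7) (MvPolynomial (Fin 3 × Fin 3) ℂ), M =
      !![1, 0, 0, 0, 0, 0, 0;
         0, 1, 0, 0, 0, 0, 0;
         0, 0, 1, 0, 0, 0, 0;
         0, 0, 0, 1, 0, 0, 0;
         -X (0,2), 0, 0, 0, 1, 0, 0;
         -X (1,2), 0, 0, 0, 0, 1, 0;
         -X (2,2), 0, 0, 0, 0, 0, 1] := ⟨_, rfl⟩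
  obtain ⟨B1, hB1⟩ : ∃ M : Matrix (Fin 7) (Fin 7) (MvPolynomial (Fin 3 × Fin 3) ℂ), M =
      !![0, X (0,0), X (1,0), X (2,0), 0, 0, 0;
         0, 1, 0, 0, 0, X (2,1), X (1,1);
         0, 0, 1, 0, X (2,1), 0, X (0,1);
         0, 0, 0, 1, X (1,1), X (0,1), 0;
         X (0,2), 0, 0, 0, 1, -X (2,2), X (1,2);
         X (1,2), 0, 0, 0, 0, 1, 0;
         X (2,2), 0, 0, 0, 0, 0, 1] := ⟨_, rfl⟩
  obtain ⟨B2, hB2⟩ : ∃ M : Matrix (Fin 7) (Fin 7) (MvPolynomial (Fin 3 × Fin 3) ℂ), M =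
      !![0, X (0,0), X (1,0), X (2,0), -(X (1,0) * X (2,1) + X (2,0) * X (1,1)),
           -(X (0,0) * X (2,1) + X (2,0) * X (0,1)), -(X (0,0) * X (1,1) + X (1,0) * X (0,1));
         0, 1, 0, 0, 0, 0, 0;
         0, 0, 1, 0, 0, 0, 0;
         0, 0, 0, 1, 0, 0, 0;
         X (0,2), 0, 0, 0, 1, -X (2,2), X (1,2);
         X (1,2), 0, 0, 0, 0, 1, 0;
         X (2,2), 0, 0, 0, 0, 0, 1] := ⟨_, rfl⟩
  obtain ⟨T, hT⟩ : ∃ M : Matrix (Fin 7) (Fin 7) (MvPolynomial (Fin 3 × Fin 3) ℂ), M =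
      !![perPoly (Fin 3) ℂ, X (0,0), X (1,0), X (2,0), -(X (1,0) * X (2,1) + X (2,0) * X (1,1)),
           -(X (0,0) * X (2,1) + X (2,0) * X (0,1)), -(X (0,0) * X (1,1) + X (1,0) * X (0,1));
         0, 1, 0, 0, 0, 0, 0;
         0, 0, 1, 0, 0, 0, 0;
         0, 0, 0, 1, 0, 0, 0;
         0, 0, 0, 0, 1, -X (2,2), X (1,2);
         0, 0, 0, 0, 0, 1, 0;
         0, 0, 0, 0, 0, 0, 1] := ⟨_, rfl⟩
  obtain ⟨L, hL⟩ : ∃ M : Matrix (Fin 7) (Fin 7) (MvPolynomial (Fin 3 × Fin 3) ℂ), M =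
      !![0, X (0,0), X (1,0), X (2,0), 0, 0, 0;
         0, 0, 0, 0, 0, X (2,1), X (1,1);
         0, -X (2,0), 0, 0, X (2,1), 0, X (0,1);
         0, X (1,0), 0, 0, X (1,1), X (0,1), 0;
         X (0,2), 0, 0, 0, 0, -X (2,2), X (1,2);
         X (1,2), 0, 0, 0, 0, 0, 0;
         X (2,2), 0, 0, 0, 0, 0, 0] := ⟨_, rfl⟩
  have p3 : perPoly (Fin 3) ℂ = X (0,0) * (X (1,1) * X (2,2) + X (2,1) * X (1,2))
      + X (1,0) * (X (0,1) * X (2,2) + X (2,1) * X (0,2))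
      + X (2,0) * (X (0,1) * X (1,2) + X (1,1) * X (0,2)) := by
    simp [perPoly, permanent_fin_three, Matrix.mvPolynomialX_apply]
  have hX1 : ∀ v : Fin 3 × Fin 3,
      homogeneousComponent 1 (X v : MvPolynomial (Fin 3 × Fin 3) ℂ) = X v :=
    fun v => homogeneousComponent_eq_self (isHomogeneous_X ℂ v)
  have h11 : homogeneousComponent 1 (1 : MvPolynomial (Fin 3 × Fin 3) ℂ) = 0 :=
    homogeneousComponent_eq_zero _ _ (by simp)
  -- ### ONE inspection of the 49 entries: the three products, triangularity, degrees, linear part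
  have big : ∀ i j : Fin 7,
      ((A * DU) i j = B1 i j ∧ (B1 * E1) i j = B2 i j ∧ (B2 * E2) i j = T i j) ∧
      ((i < j → DU i j = 0) ∧ (j < i → E1 i j = 0) ∧ (i < j → E2 i j = 0) ∧ (j < i → T i j = 0)) ∧
      (A i j).totalDegree ≤ 1 ∧ homogeneousComponent 1 (A i j) = L i j := by
    intro i j
    rw [hA, hDU, hE1, hE2, hB1, hB2, hT, hL, p3]
    fin_cases i <;> fin_cases j <;> refine ⟨⟨?_, ?_, ?_⟩, ⟨?_, ?_, ?_, ?_⟩, ?_, ?_⟩ <;>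
      simp [Matrix.mul_apply, Fin.sum_univ_seven, totalDegree_X, totalDegree_neg, hX1, h11]
    all_goals ring
  -- ### `det A = per₃` through `A * DU * E1 * E2 = T`, `T` upper triangular with diagonal `(per₃, 1, …, 1)`
  have detA : A.det = perPoly (Fin 3) ℂ := by
    have h1 : A * DU = B1 := Matrix.ext fun i j => (big i j).1.1
    have h2 : B1 * E1 = B2 := Matrix.ext fun i j => (big i j).1.2.1
    have h3 : B2 * E2 = T := Matrix.ext fun i j => (big i j).1.2.2
    have dDU : DU.det = 1 := by
      rw [Matrix.det_of_lowerTriangular DU (fun i j hij => (big i j).2.1.1 hij), Fin.prod_univ_seven, hDU]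
      simp
    have dE1 : E1.det = 1 := by
      rw [Matrix.det_of_upperTriangular (M := E1) fun i j hij => (big i j).2.1.2.1 hij,
        Fin.prod_univ_seven, hE1]
      simp
    have dE2 : E2.det = 1 := by
      rw [Matrix.det_of_lowerTriangular E2 (fun i j hij => (big i j).2.1.2.2.1 hij),
        Fin.prod_univ_seven, hE2]
      simp
    have dT : T.det = perPoly (Fin 3) ℂ := by
      rw [Matrix.det_of_upperTriangular (M := T) fun i j hij => (big i j).2.1.2.2.2 hij,
        Fin.prod_univ_seven, hT]
      simp
    have h := congrArg Matrix.det h3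
    rw [← h2, ← h1, Matrix.det_mul, Matrix.det_mul, Matrix.det_mul, dDU, dE1, dE2, dT, mul_one,
      mul_one, mul_one] at h
    exact h
  have hrepr : IsAffineDetRepr (perPoly (Fin 3) ℂ) A := ⟨fun i j => (big i j).2.2.1, detA⟩
  have hLeq : (Matrix.of fun a b => homogeneousComponent 1 (A a b)) = L :=
    Matrix.ext fun i j => (big i j).2.2.2
  -- ### the crux applied to the witness, entry `(2, 5)` of `adj L`
  have hmem : L.adjugate 2 5 ∈ Ideal.span {perPoly (Fin 3) ℂ} := by
    rw [← hLeq]; exact hNT 3 le_rfl 7 A hrepr 2 5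
  -- ### evaluation at a zero of `per₃`: `X (0, c) ↦ 0`, all other variables `↦ 1`
  obtain ⟨p, hp⟩ : ∃ p : Fin 3 × Fin 3 → ℂ, p = fun v => ![![0, 0, 0], ![1, 1, 1], ![1, 1, 1]] v.1 v.2 :=
    ⟨_, rfl⟩
  have hper0 : MvPolynomial.eval p (perPoly (Fin 3) ℂ) = 0 := by
    rw [p3, hp]; simp
  obtain ⟨r, hr⟩ := Ideal.mem_span_singleton'.1 hmem
  have h0 : MvPolynomial.eval p (L.adjugate 2 5) = 0 := by
    rw [← hr, map_mul, hper0, mul_zero]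
  have h1 : MvPolynomial.eval p (L.adjugate 2 5) = (L.map (MvPolynomial.eval p)).adjugate 2 5 := by
    have h := RingHom.map_adjugate (MvPolynomial.eval p) L
    rw [RingHom.mapMatrix_apply, RingHom.mapMatrix_apply] at h
    exact congrFun (congrFun h 2) 5
  obtain ⟨Ln, hLn⟩ : ∃ M : Matrix (Fin 7) (Fin 7) ℂ, M =
      !![0, 0, 1, 1, 0, 0, 0;
         0, 0, 0, 0, 0, 1, 1;
         0, -1, 0, 0, 1, 0, 0;
         0, 1, 0, 0, 1, 0, 0;
         0, 0, 0, 0, 0, -1, 1;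
         1, 0, 0, 0, 0, 0, 0;
         1, 0, 0, 0, 0, 0, 0] := ⟨_, rfl⟩
  have hmap : L.map (MvPolynomial.eval p) = Ln := by
    ext i j
    rw [hL, hLn, hp]
    fin_cases i <;> fin_cases j <;> simp
  -- `adj Ln 2 5 = det M'`, `M'` = `Ln` with row `5` replaced by `e₂`; `M'` is invertible
  obtain ⟨M', hM'⟩ : ∃ M : Matrix (Fin 7) (Fin 7) ℂ, M =
      !![0, 0, 1, 1, 0, 0, 0;
         0, 0, 0, 0, 0, 1, 1;
         0, -1, 0, 0, 1, 0, 0;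
         0, 1, 0, 0, 1, 0, 0;
         0, 0, 0, 0, 0, -1, 1;
         0, 0, 1, 0, 0, 0, 0;
         1, 0, 0, 0, 0, 0, 0] := ⟨_, rfl⟩
  have hupd : Ln.updateRow 5 (Pi.single 2 1) = M' := by
    ext i j
    rw [hLn, hM']
    fin_cases i <;> fin_cases j <;> simp [Matrix.updateRow_apply]
  obtain ⟨B, hB⟩ : ∃ M : Matrix (Fin 7) (Fin 7) ℂ, M =
      !![0, 0, 0, 0, 0, 0, 1;
         0, 0, -(1/2), 1/2, 0, 0, 0;
         0, 0, 0, 0, 0, 1, 0;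
         1, 0, 0, 0, 0, -1, 0;
         0, 0, 1/2, 1/2, 0, 0, 0;
         0, 1/2, 0, 0, -(1/2), 0, 0;
         0, 1/2, 0, 0, 1/2, 0, 0] := ⟨_, rfl⟩
  have hinv : M' * B = 1 := by
    ext i j
    rw [hM', hB]
    fin_cases i <;> fin_cases j <;>
      simp [Matrix.mul_apply, Fin.sum_univ_seven] <;> norm_num
  have hdet : M'.det ≠ 0 := Matrix.det_ne_zero_of_right_inverse hinv
  apply hdet
  rw [← hupd, ← Matrix.adjugate_apply, ← hmap, ← h1, h0]

end Summit.ValiantsHypothesis.Theorems
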